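import Summits.ResolutionOfSingularities.ResolutionOfSingularities.Theorems.FrobeniusLadderFInjectiveMacaulayficationRadTauLoopConditional
import HarnessLib

/-!
# (L-f) V1′ — the conditional kill of TT-τ RE-INTERFACED OVER GLOBAL FLOORS (repairs the vacuous interface of p642899 §4)
# (crux `FInjectiveMacaulayfication` stmt-ResolutionOfSingularities-15315, chain w45a; res-L1-w45a-tri-2 «GAP (LOC)» bus 2026-08-28 l.81780, retraction R5; seat res-L1-w45a-lead-1 g9)

[OURS · L1 W4.5a] Support file (`--supports stmt-ResolutionOfSingularities-15315 --as helper`); def-free, fact-free, CONDITIONAL; nothing of the crux proved, no route item refuted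
(`TauTowerConjecture` is OUR OWN candidate statement, refuted BY EVIDENCE R19.16). AI-written (weaker than expert review).

WHY. p642899 §4 `RadTauLoopConditional.not_tauTowerConjecture_of_cycle_data` typed the occurrence chain over the LOCAL floor `F 0 ⟶ Spec 𝒪_{X,v}`; but an open immersion of the
GLOBAL chart `U_L = Spec k[X]/(L)` into a scheme over `Spec 𝒪_{X,v}` is impossible (`(k[X]/(L))ˣ = kˣ` for the grading `w = (0,0,2,1,2)`, so every `U_L → Spec 𝒪_{X,v}` is constant at
`v`, while the floor is birational over `Spec 𝒪_{X,v}`) — res-L1-w45a-tri-2's «GAP (LOC)»: that theorem is TRUE BUT VACUOUS. Here the same kill is typed over GLOBAL floors: `F 0` is any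
scheme at which the conjecture has been TRANSPORTED (`hfloor : TauTowerConjecture → ∃ n, RecipeTowerFull tauCentre 2 n (F 0)` — for the bed: `F 0 = Bl_𝔪 X` global, via the conjecture at
the local floor `F 0 ×_X Spec 𝒪_{X,v}` and a LOCAL→GLOBAL tower transfer «NEG-T»), `F (i+1) ⟶ F i` blowing ups along the rad-τ centres with non-FULL floors, and `U_L ↪ F m` an open
immersion of global k-schemes — a satisfiable interface (it is what the engines of res-L1-w45a-idea-1 FB5-r7 / res-L1-w45a-tri-2 report, floor by floor).
* ★★ `not_tauTowerConjecture_of_global_cycle_data` — §3 of p642899 (`not_exists_tauTower_of_cycle`, global, unaffected) + the bad-prefix lemma + `hfloor`.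
-/

-- single-problem summit: the doubled namespace component is forced
set_option linter.dupNamespace false

noncomputable section

open AlgebraicGeometry CategoryTheory CategoryTheory.Limits Literature.AlgebraicGeometry.Resolution TopologicalSpace IsLocalRing MvPolynomial

namespace Summit.ResolutionOfSingularities.ResolutionOfSingularities.Theorems.FInjectiveMacaulayfication.RadTauLoopConditional

open Summit.ResolutionOfSingularities.ResolutionOfSingularities.Theorems.FInjectiveMacaulayfication
open SliceableCentre IntrinsicTower IntrinsicTower.Recipes FullCentreDescent

/-- ★★ **CONDITIONAL KILL OF TT-τ, GLOBAL INTERFACE.** Data: the two loop germs `L`, `M` with their chart open immersions into blowing ups along the rad-τ centres (§3 of p642899: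
`hloc`, `hτL`, `hτM`, `BL, πL, hπL, jM`, `BM, πM, hπM, jL`); a prefix `F 0 ← F 1 ← … ← F m` of blowing ups along the rad-τ centres (`hg'`) with a non-FULL point on every `F i`, `i < m`
(`hbad`); the conjecture transported to `F 0` (`hfloor`); an open immersion `U_L ⟶ F m` (`hocc`). Then `TauTowerConjecture` is FALSE. [OURS · CONDITIONAL on the named data] -/
theorem not_tauTowerConjecture_of_global_cycle_data (k : Type) [Field k] [CharP k 2] (L M : MvPolynomial (Fin 5) k)
    (hL : L = X 4 ^ 2 + X 0 ^ 2 * X 2 * X 4 + X 0 * X 2 ^ 2 + X 0 * X 2 * X 3 ^ 2 + X 0 * X 1 ^ 3 * X 2 ^ 2)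
    (hM : M = X 4 ^ 2 + X 0 ^ 2 * X 2 * X 4 + X 0 * X 2 ^ 2 + X 0 ^ 2 * X 2 * X 3 ^ 2 + X 0 * X 1 ^ 3 * X 2 ^ 2)
    (hloc : ∀ {U S : Scheme.{0}} (j : U ⟶ S) [IsOpenImmersion j], (tauCentre 2 S).comap j = tauCentre 2 U)
    (hτL : tauCentre 2 (Spec (.of (MvPolynomial (Fin 5) k ⧸ Ideal.span {L}))) =
      affineBlowup.idealSheaf (Ideal.span ({Ideal.Quotient.mk (Ideal.span {L}) (X 0), Ideal.Quotient.mk (Ideal.span {L}) (X 2),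
        Ideal.Quotient.mk (Ideal.span {L}) (X 3), Ideal.Quotient.mk (Ideal.span {L}) (X 4)} : Set (MvPolynomial (Fin 5) k ⧸ Ideal.span {L}))))
    (hτM : tauCentre 2 (Spec (.of (MvPolynomial (Fin 5) k ⧸ Ideal.span {M}))) =
      affineBlowup.idealSheaf (Ideal.span ({Ideal.Quotient.mk (Ideal.span {M}) (X 0), Ideal.Quotient.mk (Ideal.span {M}) (X 2),
        Ideal.Quotient.mk (Ideal.span {M}) (X 4)} : Set (MvPolynomial (Fin 5) k ⧸ Ideal.span {M}))))
    (BL : Scheme.{0}) (πL : BL ⟶ Spec (.of (MvPolynomial (Fin 5) k ⧸ Ideal.span {L})))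
    (hπL : IsBlowup πL (tauCentre 2 (Spec (.of (MvPolynomial (Fin 5) k ⧸ Ideal.span {L})))))
    (jM : Spec (.of (MvPolynomial (Fin 5) k ⧸ Ideal.span {M})) ⟶ BL) [IsOpenImmersion jM]
    (BM : Scheme.{0}) (πM : BM ⟶ Spec (.of (MvPolynomial (Fin 5) k ⧸ Ideal.span {M})))
    (hπM : IsBlowup πM (tauCentre 2 (Spec (.of (MvPolynomial (Fin 5) k ⧸ Ideal.span {M})))))
    (jL : Spec (.of (MvPolynomial (Fin 5) k ⧸ Ideal.span {L})) ⟶ BM) [IsOpenImmersion jL]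
    -- the occurrence chain over GLOBAL floors
    (m : ℕ) (F : ℕ → Scheme.{0}) (g' : ∀ i : ℕ, F (i + 1) ⟶ F i)
    (hfloor : TauTowerConjecture → ∃ n : ℕ, RecipeTowerFull tauCentre 2 n (F 0))
    (hg' : ∀ i, i < m → IsBlowup (g' i) (tauCentre 2 (F i)))
    (hbad : ∀ i, i < m → ∃ s : F i, ¬ FullCl 2 ((F i).presheaf.stalk s))
    (hocc : ∃ j : Spec (.of (MvPolynomial (Fin 5) k ⧸ Ideal.span {L})) ⟶ F m, IsOpenImmersion j) :
    ¬ TauTowerConjecture := by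
  intro hTT
  have hend : ¬ ∃ n : ℕ, RecipeTowerFull tauCentre 2 n (F m) :=
    not_exists_tauTower_of_cycle k L M hL hM hloc hτL hτM BL πL hπL jM BM πM hπM jL (F m) hocc
  exact not_exists_tower_of_bad_prefix (fun S s => FullCl 2 (S.presheaf.stalk s)) (RecipeTowerFull tauCentre 2) (tauCentre 2)
    (fun _ h => h) (fun _ _ h => h) m F g' hg' hbad hend (hfloor hTT)

end Summit.ResolutionOfSingularities.ResolutionOfSingularities.Theorems.FInjectiveMacaulayfication.RadTauLoopConditional

end
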